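import Summits.AtomisticToContinuum.HydrodynamicLimit.Theses.BallisticLaceBootstrap

/-!
# Crux `FlowMarginalSymmetry` (stmt-AtomisticToContinuum-12109) — birth skeleton (BC3), line `birth`

Route `route-AtomisticToContinuum-BallisticLaceBootstrap`, sub-problem `HydrodynamicLimit`.
The crux (route file `Theses/BallisticLaceBootstrap.lean`, decl concluded BY NAME below): for every
`σ > 0`, profiles `(a₀, u₀, θ₀)`, `N`, every hard-sphere flow `Φ` of `N + 1` spheres of diameter
`hsDiameter σ N` on `𝕋³`, every `t` and every permutation `π` of the labels, the transported local
Gibbs weight `W = 1_D · (canonicalDensity ∘ Φ_{-t})` satisfies `W ∘ (· ∘ π) = W` for `volume`-a.e.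
configuration (the a.e. relabelling-symmetry hypothesis of `MarginalsToL2`, for ARBITRARY flows).

The cut (two named stubs = the two mathematically distinct ingredients; the measure-theoretic
glue — `volume` versus Liouville null sets, the domain indicator, the case split on `z ∈ D` — is
the sorry-free composition `FlowMarginalSymmetry_of`):

* `stub_flowCompPermAE` — DYNAMICS: a hard-sphere flow on `𝕋³` commutes with relabelling of the
  particles for `volume`-a.e. configuration OF THE HARD-SPHERE DOMAIN, at every time and for every
  `N`, `ε` (relabelled hard-sphere trajectories are hard-sphere trajectories + forward uniqueness on
  the good set + invariance of the Liouville measure under the flow and under relabelling; off the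
  domain the flow is junk and nothing is claimed). This is the Liouville-a.e. covariance
  `Literature.Analysis.FluidPDE.HardSphereFlow.flow_comp_perm_ae` (HardSphereUniqueness.lean, proved)
  moved to `volume` through `liouville = volume.restrict D`; size S.
* `stub_canonicalDensityCompPerm` — STATICS: the canonical Gibbs-type density
  `𝒵⁻¹ · 1_D · f₀^{⊗N}` of ANY one-particle profile `f₀` on `𝕋³ × ℝ³` is label-symmetric
  (`Fintype.prod_equiv` on the tensor power, relabelling invariance of `D`); the library has it as
  `Literature.MathematicalPhysics.KineticTheory.canonicalDensity_comp_perm` /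
  `isSymmetricFn_canonicalDensity`; size S.

Both stubs are strictly weaker than the crux in kind (stub 1 says nothing about densities, stub 2
nothing about flows) and neither mentions the summit. Sorries: exactly two, one inside each
`stub_*`; `FlowMarginalSymmetry_of` and `FlowMarginalSymmetry_skeleton` contain none of their own.
Disproof used: none on file (`ledger crux ls stmt-AtomisticToContinuum-12109`: no workfiles, no
`Disproof.lean`, no Negative lemmas; the item carries a refuter's sorry-free candidate proof,
evidence `FlowMarginalSymmetryProof.lean`, 2026-08-15).
-/

namespace Summit.AtomisticToContinuum.HydrodynamicLimit.Cruxes.FlowMarginalSymmetry.Birth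

open MeasureTheory

/-- STUB 1 · DYNAMICS — relabelling covariance of the hard-sphere flow, `volume`-a.e. on the
hard-sphere domain: for every `N`, `ε`, every hard-sphere flow `Φ` of `N` spheres of diameter `ε`
on `𝕋³`, every time `t` and permutation `π`, for `volume`-a.e. configuration `z`, if `z ∈ D_ε^N`
then `Φ_t (z ∘ π) = (Φ_t z) ∘ π`. (Liouville-a.e. form: `HardSphereFlow.flow_comp_perm_ae`.) -/
theorem stub_flowCompPermAE :
    ∀ (N : ℕ) (ε : ℝ) (Φ : Literature.Analysis.FluidPDE.HardSphereFlow (Literature.Analysis.FluidPDE.Torus.geometry (Fin 3)) ε N) (t : ℝ) (π : Equiv.Perm (Fin N)), ∀ᵐ z ∂(MeasureTheory.volume : MeasureTheory.Measure (Literature.Analysis.FluidPDE.Config N (Fin 3) Literature.MathematicalPhysics.KineticTheory.T3)), z ∈ Literature.Analysis.FluidPDE.hardSphereDomain (Literature.Analysis.FluidPDE.Torus.geometry (Fin 3)) N ε → Φ.flow t (z ∘ ⇑π) = Φ.flow t z ∘ ⇑π := by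
  sorry

/-- STUB 2 · STATICS — label symmetry of the canonical Gibbs-type density of an arbitrary
one-particle profile `f₀` on `𝕋³ × ℝ³`: `canonicalDensity (z ∘ π) = canonicalDensity z` for every
`N`, `ε`, `π`, `z`. (Library: `canonicalDensity_comp_perm`, `isSymmetricFn_canonicalDensity`.) -/
theorem stub_canonicalDensityCompPerm :
    ∀ (N : ℕ) (ε : ℝ) (f₀ : Literature.MathematicalPhysics.KineticTheory.T3 × Literature.MathematicalPhysics.KineticTheory.V3 → ℝ) (π : Equiv.Perm (Fin N)) (z : Literature.Analysis.FluidPDE.Config N (Fin 3) Literature.MathematicalPhysics.KineticTheory.T3), Literature.Analysis.FluidPDE.canonicalDensity (Literature.Analysis.FluidPDE.Torus.geometry (Fin 3)) ε N f₀ (z ∘ ⇑π) = Literature.Analysis.FluidPDE.canonicalDensity (Literature.Analysis.FluidPDE.Torus.geometry (Fin 3)) ε N f₀ z := by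
  sorry

/-! ## The composition: the two stubs conclude the crux BY NAME (real proof, no `sorry`) -/

/-- **`FlowMarginalSymmetry` from the line.** Fix `σ, a₀, θ₀, u₀, N, Φ, t, π`. By stub 1 at time
`-t` (the time inside `hsTransport`), for `volume`-a.e. `z`: if `z ∈ D` then
`Φ_{-t} (z ∘ π) = (Φ_{-t} z) ∘ π`. At such a `z`: if `z ∈ D` then also `z ∘ π ∈ D`
(`comp_perm_mem_hardSphereDomain_iff`), both indicators are `1`, and
`W (z ∘ π) = cD (Φ_{-t} (z ∘ π)) = cD ((Φ_{-t} z) ∘ π) = cD (Φ_{-t} z) = W z` by stub 2; if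
`z ∉ D` then `z ∘ π ∉ D` and both sides are `0`. -/
theorem FlowMarginalSymmetry_of :
    (∀ (N : ℕ) (ε : ℝ) (Φ : Literature.Analysis.FluidPDE.HardSphereFlow (Literature.Analysis.FluidPDE.Torus.geometry (Fin 3)) ε N) (t : ℝ) (π : Equiv.Perm (Fin N)), ∀ᵐ z ∂(MeasureTheory.volume : MeasureTheory.Measure (Literature.Analysis.FluidPDE.Config N (Fin 3) Literature.MathematicalPhysics.KineticTheory.T3)), z ∈ Literature.Analysis.FluidPDE.hardSphereDomain (Literature.Analysis.FluidPDE.Torus.geometry (Fin 3)) N ε → Φ.flow t (z ∘ ⇑π) = Φ.flow t z ∘ ⇑π) →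
    (∀ (N : ℕ) (ε : ℝ) (f₀ : Literature.MathematicalPhysics.KineticTheory.T3 × Literature.MathematicalPhysics.KineticTheory.V3 → ℝ) (π : Equiv.Perm (Fin N)) (z : Literature.Analysis.FluidPDE.Config N (Fin 3) Literature.MathematicalPhysics.KineticTheory.T3), Literature.Analysis.FluidPDE.canonicalDensity (Literature.Analysis.FluidPDE.Torus.geometry (Fin 3)) ε N f₀ (z ∘ ⇑π) = Literature.Analysis.FluidPDE.canonicalDensity (Literature.Analysis.FluidPDE.Torus.geometry (Fin 3)) ε N f₀ z) →
    Summit.AtomisticToContinuum.HydrodynamicLimit.Theses.BallisticLaceBootstrap.FlowMarginalSymmetry := by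
  intro hflow hcan σ a₀ θ₀ u₀ _hσ N Φ t π
  -- the `let W := …` of the crux is ζ-reduced
  dsimp only
  filter_upwards [hflow (N + 1) (Literature.MathematicalPhysics.KineticTheory.hsDiameter σ N) Φ (-t) π]
    with z hz
  by_cases hD : z ∈ Literature.Analysis.FluidPDE.hardSphereDomain
      (Literature.Analysis.FluidPDE.Torus.geometry (Fin 3)) (N + 1)
      (Literature.MathematicalPhysics.KineticTheory.hsDiameter σ N)
  · -- on the domain: both indicators are `1`, transport = evaluation at `Φ_{-t}`, then stubs 1, 2
    have hDπ : (z ∘ ⇑π) ∈ Literature.Analysis.FluidPDE.hardSphereDomain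
        (Literature.Analysis.FluidPDE.Torus.geometry (Fin 3)) (N + 1)
        (Literature.MathematicalPhysics.KineticTheory.hsDiameter σ N) :=
      (Literature.Analysis.FluidPDE.comp_perm_mem_hardSphereDomain_iff _ _ π z).2 hD
    rw [Set.indicator_of_mem hDπ, Set.indicator_of_mem hD,
      Literature.Analysis.FluidPDE.hsTransport_apply, Literature.Analysis.FluidPDE.hsTransport_apply,
      hz hD, hcan]
  · -- off the domain: both sides vanish
    have hDπ : (z ∘ ⇑π) ∉ Literature.Analysis.FluidPDE.hardSphereDomain
        (Literature.Analysis.FluidPDE.Torus.geometry (Fin 3)) (N + 1)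
        (Literature.MathematicalPhysics.KineticTheory.hsDiameter σ N) :=
      fun h => hD ((Literature.Analysis.FluidPDE.comp_perm_mem_hardSphereDomain_iff _ _ π z).1 h)
    rw [Set.indicator_of_notMem hDπ, Set.indicator_of_notMem hD]

/-- The composition instantiated with the two stubs: the crux, modulo exactly the two `sorry`s. -/
theorem FlowMarginalSymmetry_skeleton :
    Summit.AtomisticToContinuum.HydrodynamicLimit.Theses.BallisticLaceBootstrap.FlowMarginalSymmetry :=
  FlowMarginalSymmetry_of stub_flowCompPermAE stub_canonicalDensityCompPerm

end Summit.AtomisticToContinuum.HydrodynamicLimit.Cruxes.FlowMarginalSymmetry.Birth
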